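import Literature.MathematicalPhysics.QuantumLattice.TorusShellCountUniform
import Literature.MathematicalPhysics.QuantumLattice.TorusShellCounting
import HarnessLib

/-!
# Particle–hole symmetry of the even torus band and the location of Fermi levels

Family `hubbard` / topic `MathematicalPhysics/QuantumLattice`. Counting lemmas for the band
`ε_L(k) = -2(cos(2πk₁/L) + cos(2πk₂/L))` of the square torus `(ℤ/Lℤ)²` (`torusBand`) with EVEN `L`:

* `torusBand_add_halfShift` — the half-zone shift `Q = (L/2, L/2)` flips the band,
  `ε_L(k + Q) = -ε_L(k)` (`cos(θ + π) = -cos θ`);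
* `card_filter_torusBand_lt_neg_eq` — hence `#{ε < -t} = #{t < ε}`, and
  (`two_mul_card_filter_lt_neg_add_card_shell`) `2·#{ε < -t} + #{|ε| ≤ t} = L²` for `t ≥ 0`;
* `sub_le_two_mul_card_filter_torusBand_le_neg` — with the uniform shell count
  (`card_torusShell_le_sqrt` at the van Hove level): `L² - √t·L² - 2L ≤ 2·#{ε ≤ -t}`: slightly less
  than half of the Brillouin zone lies below `-t`;
* `card_filter_torusBand_lt_neg_four_add_le` — near the band bottom, `#{ε < -4 + t} ≤ √t·L² + 2L`
  (any `L`);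
* `exists_level_mem_Icc_of_card` (abstract) — a set `F` of `n` lowest levels of `ε : ι → ℝ`
  (exchange property) with `n ≤ #{ε ≤ b}` and `#{ε < a} < n` has a separating level in `[a, b]`
  (its maximum).

These feed the Fermi-level hypotheses of the logarithmic pairing-cost rate
(`FreeFermiGasPairingCostLog.lean`): at filling `1 - δ`, `δ ∈ (0, 1/2)`, even `L`, the Fermi level
of `⌊(1-δ)L²/2⌋` levels per spin lies in `[-4 + d₀, -d₀]` with `d₀ ≍ δ²`, away from the van Hove
level `0` and from the band bottom.

Sources: folklore (bipartite-lattice particle–hole symmetry `ε_{k+Q} = -ε_k`, e.g. E. H. Lieb,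
Phys. Rev. Lett. 62 (1989) 1201; lattice-point counting). No named facts, no definitions.

## Mathlib / tree search

Tree: `torusBand_two_eq`, `card_torusShell_le_sqrt`, `card_torusSite`, `neg_four_le_torusBand`,
`neelIndex` / `latticeMomentum_neelIndex` (Heisenberg files; not imported — the shift is inlined),
`torusFermiLevel_mem_Icc` (localisation away from the band EDGES for the canonical shell level).
Mathlib: `Finset.card_equiv`, `Equiv.addRight`, `ZMod.val_add`, `ZMod.val_natCast`,
`Real.cos_add_pi`, `Real.cos_sub_nat_mul_two_pi`, `Finset.filter_card_add_filter_neg_card_eq_card`,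
`Finset.exists_mem_eq_sup'`.
-/

noncomputable section

namespace Literature.MathematicalPhysics.QuantumLattice

open Finset Real Literature.Probability.LatticeModels

/-! ### The half-zone shift flips the even band -/

section ParticleHole

variable {L : ℕ} [NeZero L]

/-- Reducing the representative modulo `L` does not change the lattice cosine (local copy of the
`DWaveGapLatticeCount` lemma, to keep the import light). [folklore] -/
private theorem cos_two_pi_mul_mod_div' (x L : ℕ) (hL : (0 : ℝ) < L) :
    Real.cos (2 * π * ((x % L : ℕ) : ℝ) / L) = Real.cos (2 * π * (x : ℝ) / L) := by
  have h := Nat.mod_add_div x L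
  have hx : ((x % L : ℕ) : ℝ) = (x : ℝ) - L * ((x / L : ℕ) : ℝ) := by
    have : ((x % L : ℕ) : ℝ) + L * ((x / L : ℕ) : ℝ) = x := by exact_mod_cast h
    linarith
  rw [hx, show 2 * π * ((x : ℝ) - L * ((x / L : ℕ) : ℝ)) / L =
      2 * π * (x : ℝ) / L - ((x / L : ℕ) : ℝ) * (2 * π) by field_simp,
    Real.cos_sub_nat_mul_two_pi]

/-- **Particle–hole symmetry of the even torus band**: for even `L` and the half-zone shift
`Q = (L/2, L/2)`, `ε_L(k + Q) = -ε_L(k)`. Lieb (1989). [folklore] -/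
theorem torusBand_add_halfShift (hL : Even L) (k : TorusSite 2 L) :
    torusBand L (k + (fun _ => ((L / 2 : ℕ) : ZMod L) : TorusSite 2 L)) = -torusBand L k := by
  obtain ⟨m, hm⟩ := hL
  have hLpos : 0 < L := Nat.pos_of_ne_zero (NeZero.ne L)
  have hLr : (0 : ℝ) < L := by exact_mod_cast hLpos
  have hm2 : L / 2 = m := by omega
  have hval : (((L / 2 : ℕ) : ZMod L)).val = m := by
    rw [ZMod.val_natCast, Nat.mod_eq_of_lt (Nat.div_lt_self hLpos one_lt_two), hm2]
  have hcos : ∀ i : Fin 2,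
      Real.cos (2 * π * (((k + (fun _ => ((L / 2 : ℕ) : ZMod L) : TorusSite 2 L)) i).val : ℝ) / L) =
      -Real.cos (2 * π * ((k i).val : ℝ) / L) := by
    intro i
    rw [Pi.add_apply, ZMod.val_add, hval, cos_two_pi_mul_mod_div' _ _ hLr, Nat.cast_add]
    have hπ : 2 * π * ((k i).val + (m : ℝ)) / L = 2 * π * ((k i).val : ℝ) / L + π := by
      have hLm : (L : ℝ) = 2 * m := by rw [hm]; push_cast; ring
      rw [hLm]
      have hm0 : (m : ℝ) ≠ 0 := by
        have : 0 < m := by omega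
        exact_mod_cast this.ne'
      field_simp
    rw [hπ, Real.cos_add_pi]
  rw [torusBand_two_eq, torusBand_two_eq, hcos 0, hcos 1]
  ring

/-- For even `L`: `#{k : ε_L(k) < -t} = #{k : t < ε_L(k)}` (the half-zone shift is a bijection
between the two sets). [folklore] -/
theorem card_filter_torusBand_lt_neg_eq (hL : Even L) (t : ℝ) :
    (univ.filter fun k : TorusSite 2 L => torusBand L k < -t).card =
      (univ.filter fun k : TorusSite 2 L => t < torusBand L k).card := by
  symm
  refine Finset.card_equiv (Equiv.addRight (fun _ => ((L / 2 : ℕ) : ZMod L) : TorusSite 2 L)) ?_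
  intro k
  simp only [mem_filter, mem_univ, true_and, Equiv.coe_addRight, torusBand_add_halfShift hL]
  constructor <;> intro h <;> linarith

/-- For even `L` and `t ≥ 0`: `2·#{ε < -t} + #{|ε| ≤ t} = L²` (below, shell, above; the outer two
are equinumerous). [folklore] -/
theorem two_mul_card_filter_lt_neg_add_card_shell (hL : Even L) {t : ℝ} (ht : 0 ≤ t) :
    2 * (univ.filter fun k : TorusSite 2 L => torusBand L k < -t).card +
        (univ.filter fun k : TorusSite 2 L => |torusBand L k - 0| ≤ t).card = L ^ 2 := by
  classical
  have h1 := Finset.card_filter_add_card_filter_not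
    (s := (univ : Finset (TorusSite 2 L))) (fun k => torusBand L k < -t)
  have h2 := Finset.card_filter_add_card_filter_not
    (s := (univ : Finset (TorusSite 2 L)).filter fun k => ¬ torusBand L k < -t)
    (fun k => t < torusBand L k)
  rw [Finset.filter_filter, Finset.filter_filter] at h2
  have hab : ((univ : Finset (TorusSite 2 L)).filter fun k => ¬torusBand L k < -t ∧ t < torusBand L k) =
      univ.filter fun k : TorusSite 2 L => t < torusBand L k := by
    refine Finset.filter_congr fun k _ => ⟨fun h => h.2, fun h => ⟨by linarith, h⟩⟩
  have hsh : ((univ : Finset (TorusSite 2 L)).filter fun k => ¬torusBand L k < -t ∧ ¬t < torusBand L k) =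
      univ.filter fun k : TorusSite 2 L => |torusBand L k - 0| ≤ t := by
    refine Finset.filter_congr fun k _ => ?_
    rw [sub_zero, abs_le, not_lt, not_lt]
  rw [hab, hsh, ← card_filter_torusBand_lt_neg_eq hL t] at h2
  rw [Finset.card_univ, card_torusSite] at h1
  omega

/-- **Slightly less than half of the zone lies below `-t`** (even `L`, `t ≥ 0`):
`L² - √t·L² - 2L ≤ 2·#{k : ε_L(k) ≤ -t}` (the shell `|ε| ≤ t` at the van Hove level holds at most
`√t L² + 2L` momenta, `card_torusShell_le_sqrt`). [folklore] -/
theorem sub_le_two_mul_card_filter_torusBand_le_neg (hL : Even L) {t : ℝ} (ht : 0 ≤ t) :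
    (L : ℝ) ^ 2 - Real.sqrt t * (L : ℝ) ^ 2 - 2 * L ≤
      2 * ((univ.filter fun k : TorusSite 2 L => torusBand L k ≤ -t).card : ℝ) := by
  have h := two_mul_card_filter_lt_neg_add_card_shell hL ht
  have hsh := card_torusShell_le_sqrt (L := L) 0 t
  have hmono : ((univ.filter fun k : TorusSite 2 L => torusBand L k < -t).card : ℝ) ≤
      ((univ.filter fun k : TorusSite 2 L => torusBand L k ≤ -t).card : ℝ) := by
    exact_mod_cast Finset.card_le_card (Finset.monotone_filter_right _ fun k _ hk => le_of_lt hk)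
  have h' : 2 * ((univ.filter fun k : TorusSite 2 L => torusBand L k < -t).card : ℝ) +
      ((univ.filter fun k : TorusSite 2 L => |torusBand L k - 0| ≤ t).card : ℝ) = (L : ℝ) ^ 2 := by
    exact_mod_cast h
  linarith

omit [NeZero L] in
/-- **Near the band bottom**: `#{k : ε_L(k) < -4 + t} ≤ √t·L² + 2L` (`ε ≥ -4`, so these momenta lie
in the shell `|ε + 4| ≤ t`). [folklore] -/
theorem card_filter_torusBand_lt_neg_four_add_le [NeZero L] (t : ℝ) :
    ((univ.filter fun k : TorusSite 2 L => torusBand L k < (-4 : ℝ) + t).card : ℝ) ≤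
      Real.sqrt t * (L : ℝ) ^ 2 + 2 * L := by
  refine le_trans ?_ (card_torusShell_le_sqrt (L := L) (-4 : ℝ) t)
  have hsub : (univ.filter fun k : TorusSite 2 L => torusBand L k < (-4 : ℝ) + t) ⊆
      univ.filter fun k : TorusSite 2 L => |torusBand L k - (-4 : ℝ)| ≤ t :=
    Finset.monotone_filter_right _ fun k _ hk => by
      have h4 := neg_four_le_torusBand L k
      rw [show torusBand L k - (-4 : ℝ) = torusBand L k + 4 by ring, abs_le]
      constructor <;> linarith
  exact_mod_cast Finset.card_le_card hsub

end ParticleHole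

/-! ### Location of a separating level -/

section Level

variable {ι : Type*} [Fintype ι] [DecidableEq ι]

/-- **A set of lowest levels has its Fermi level where the counting function says.** Let `F` be a
set of `n` lowest levels of `ε : ι → ℝ` (exchange property: `ε k ≤ ε k'` for `k ∈ F`, `k' ∉ F`). If
`n ≤ #{ε ≤ b}` and `#{ε < a} < n`, then some level `ε_F ∈ [a, b]` separates `F` from its complement
(`ε ≤ ε_F` on `F`, `ε_F ≤ ε` off `F`): take `ε_F = max_F ε`. [folklore] -/
theorem exists_level_mem_Icc_of_card (ε : ι → ℝ) (F : Finset ι) {a b : ℝ}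
    (hex : ∀ k ∈ F, ∀ k' ∉ F, ε k ≤ ε k')
    (hb : F.card ≤ (univ.filter fun k => ε k ≤ b).card)
    (ha : (univ.filter fun k => ε k < a).card < F.card) :
    ∃ eF : ℝ, a ≤ eF ∧ eF ≤ b ∧ (∀ k ∈ F, ε k ≤ eF) ∧ (∀ k ∉ F, eF ≤ ε k) := by
  have hFne : F.Nonempty := Finset.card_pos.1 (lt_of_le_of_lt (Nat.zero_le _) ha)
  obtain ⟨k₀, hk₀, hk₀eq⟩ := Finset.exists_mem_eq_sup' hFne ε
  refine ⟨F.sup' hFne ε, ?_, ?_, fun k hk => Finset.le_sup' ε hk, fun k' hk' => ?_⟩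
  · -- `a ≤ max_F ε`: otherwise `F ⊆ {ε < a}`
    by_contra hlt
    push Not at hlt
    have hsub : F ⊆ univ.filter fun k => ε k < a := fun k hk =>
      mem_filter.2 ⟨mem_univ _, lt_of_le_of_lt (Finset.le_sup' ε hk) hlt⟩
    exact absurd (Finset.card_le_card hsub) (not_le.2 ha)
  · -- `max_F ε ≤ b`: otherwise `{ε ≤ b} ⊆ F \ {k₀}`
    by_contra hlt
    push Not at hlt
    rw [hk₀eq] at hlt
    have hsub : (univ.filter fun k => ε k ≤ b) ⊆ F.erase k₀ := by
      intro k hk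
      rw [mem_filter] at hk
      rw [mem_erase]
      refine ⟨fun h => ?_, ?_⟩
      · rw [h] at hk; linarith [hk.2]
      · by_contra hkF
        have := hex k₀ hk₀ k hkF
        linarith [hk.2]
    have h1 := Finset.card_le_card hsub
    rw [Finset.card_erase_of_mem hk₀] at h1
    have h2 : 0 < F.card := Finset.card_pos.2 hFne
    omega
  · rw [hk₀eq]
    exact hex k₀ hk₀ k' hk'

end Level

end Literature.MathematicalPhysics.QuantumLattice
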